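import Summits.AnomalousDissipation.AnomalousDissipation.Theorems.MomentParityCoupling
import Literature.Analysis.FunctionSpaces.TorusSobolevNormProofs

/-!
# Route MomentParity · crux `GalerkinEnsembleRealization` — line `Sketch`, stub `stub_realisation`

The Leray–Hopf step of the realisation of a Vishik–Fursikov limit path
(stmt-AnomalousDissipation-11466; Foias–Rosa–Temam 2013, proof of Thm. 3.1; Robinson–Rodrigo–
Sadowski 2016, Thm. 4.6 and the remark on abstract sequences, p. 82): a path `ω` of the
trajectory space `𝒦 = pathSpace R (pathLip ν A R)` which is the pointwise limit (at every `t ≥ 0`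
and frequency) of the orbit paths of confined Galerkin orbits of levels `N j → ∞` is realised,
after a time shift `s ≥ 0`, by a global Leray–Hopf solution `u` of the Navier–Stokes equations
with the steady force `f`: `𝓕(u t)(k) = ω̄(s + t, k)` for all `t ≥ 0`.

**Restart at an a.e. strong time.** The Galerkin orbits form a Hopf–Galerkin family converging
coefficientwise to the field of `ω` (`MomentParityFamilyOfOrbits`, `MomentParityPathField`); by
`IsHopfGalerkinFamily.exists_strictMono_ae_tendsto_eLpNorm` a subsequence converges strongly in
`L²` at almost every time `s ∈ (0, 1)`. Fix such an `s`. By the semigroup law of the Galerkin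
flow the orbits restarted at time `s` are again confined Galerkin orbits (data `φ_s c_j`), they
converge coefficientwise to the field of `ω` shifted by `s` and strongly at the new time `0`, so
`IsHopfGalerkinFamily.isGlobalLerayHopf_limit` applies from the datum `u 0`.
-/

noncomputable section

-- every `Summit.AnomalousDissipation.AnomalousDissipation.…` name repeats the summit = sub-problem segment (D-0017 layout)
set_option linter.dupNamespace false

open MeasureTheory Set Filter Topology Function Metric UnitAddTorus
open scoped BigOperators ENNReal InnerProductSpace RealInnerProductSpace

namespace Summit.AnomalousDissipation.AnomalousDissipation.Theorems.MomentParity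

open Literature.Analysis.FunctionSpaces Literature.Analysis.FunctionSpaces.Torus
open Literature.Analysis.FluidPDE Literature.Analysis.FluidPDE.Torus

variable {ν : ℝ} {f : UnitAddTorus (Fin 3) → EuclideanSpace ℝ (Fin 3)}

/-- **Two `L²` fields with the same Fourier coefficients have `L²` distance zero** (uniqueness of
Fourier coefficients, Grafakos 2014, Prop. 3.2.4, through the complexification). -/
theorem eLpNorm_sub_eq_zero_of_mFourierCoeff_eq {v w : UnitAddTorus (Fin 3) → EuclideanSpace ℝ (Fin 3)}
    (hv : MemLp v 2 volume) (hw : MemLp w 2 volume)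
    (h : ∀ k, mFourierCoeff (EuclideanSpace.complexify ∘ v) k =
      mFourierCoeff (EuclideanSpace.complexify ∘ w) k) :
    eLpNorm (v - w) 2 volume = 0 := by
  have hvi : Integrable (EuclideanSpace.complexify ∘ v) volume :=
    EuclideanSpace.complexify.toContinuousLinearMap.integrable_comp (hv.integrable one_le_two)
  have hwi : Integrable (EuclideanSpace.complexify ∘ w) volume :=
    EuclideanSpace.complexify.toContinuousLinearMap.integrable_comp (hw.integrable one_le_two)
  have hae := ae_eq_of_forall_mFourierCoeff_eq hvi hwi h
  have hae' : v =ᵐ[volume] w := by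
    filter_upwards [hae] with x hx
    exact EuclideanSpace.complexify_injective hx
  rw [eLpNorm_congr_ae (hae'.sub (EventuallyEq.refl _ w)), sub_self, eLpNorm_zero]

/-- **Stub (realisation).** A path `ω ∈ 𝒦` which is the pointwise limit of orbit paths of confined
Galerkin orbits of levels `N j → ∞` is realised, after a time shift `s ≥ 0`, by a global
Leray–Hopf solution: `𝓕(u t)(k) = ω̄(s + t, k)` for all `t ≥ 0`. -/
theorem stub_realisation (hν : 0 < ν) (hf : IsSmooth f) {R A : ℝ} {N : ℕ → ℕ}
    (hN : Tendsto N atTop atTop)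
    {c : (j : ℕ) → ↥(freqBall (N j) : Finset (Fin 3 → ℤ)) → EuclideanSpace ℂ (Fin 3)}
    (hc : ∀ j, c j ∈ galerkinSubspace (freqBall (N j)))
    (hconf : ∀ j t, 0 ≤ t → ∑ k ∈ freqBall (N j), ‖coeffExt (freqBall (N j))
      (galerkinCoeffFlow ν (fourierRestrict (freqBall (N j)) f) t (c j)) k‖ ^ 2 ≤ R ^ 2)
    (hmem : ∀ j, orbitPath ν (fourierRestrict (freqBall (N j)) f) (c j) ∈ pathSpace R (pathLip ν A R))
    {ω : Path (Fin 3)} (hω : ω ∈ pathSpace R (pathLip ν A R))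
    (hlim : ∀ t, 0 ≤ t → ∀ k, Tendsto
      (fun j => pathExt (orbitPath ν (fourierRestrict (freqBall (N j)) f) (c j)) t k) atTop
      (𝓝 (pathExt ω t k))) :
    ∃ s : ℝ, 0 ≤ s ∧ ∃ u : ℝ → UnitAddTorus (Fin 3) → EuclideanSpace ℝ (Fin 3),
      IsGlobalLerayHopf ν (fun _ => f) (u 0) u ∧
      ∀ t, 0 ≤ t → MemLp (u t) 2 volume ∧
        ∀ k, mFourierCoeff (EuclideanSpace.complexify ∘ u t) k = pathExt ω (s + t) k := by
  have hS : ∀ j, ∀ k ∈ (freqBall (N j) : Finset (Fin 3 → ℤ)), -k ∈ (freqBall (N j) : Finset (Fin 3 → ℤ)) := fun j =>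
    neg_mem_freqBall_of_mem
  have hg : ∀ j, IsRealCoeff (fourierRestrict (freqBall (N j)) f) := fun j =>
    isRealCoeff_mFourierCoeff hf.integrable
  have hR : ∀ j, ∑ k ∈ freqBall (N j), ‖coeffExt (freqBall (N j)) (c j) k‖ ^ 2 ≤ R ^ 2 := fun j => by
    simpa only [galerkinCoeffFlow_zero] using hconf j 0 le_rfl
  -- the Galerkin orbits as a Hopf–Galerkin family
  obtain ⟨U, hU⟩ : ∃ U : ℕ → ℝ → UnitAddTorus (Fin 3) → EuclideanSpace ℝ (Fin 3),
      U = fun j t => galerkinFlow ν f (N j) t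
        (realTrigPoly (freqBall (N j)) (coeffExt (freqBall (N j)) (c j))) := ⟨_, rfl⟩
  have hUjt : ∀ j t, U j t = galerkinFlow ν f (N j) t
      (realTrigPoly (freqBall (N j)) (coeffExt (freqBall (N j)) (c j))) := fun j t => by rw [hU]
  have hF : IsHopfGalerkinFamily ν (fun _ => f) (fun _ => EuclideanSpace.single (0 : Fin 3) R) N
      (fun _ _ => f) U := by
    rw [hU]; exact isHopfGalerkinFamily_galerkinFlow hν.le hf hN hc hR
  -- common data for the family theorems
  have hu₀ : MemLp (fun _ : UnitAddTorus (Fin 3) => EuclideanSpace.single (0 : Fin 3) R) 2 volume :=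
    memLp_const _
  have hfm := aestronglyMeasurable_stLift_const hf (volume.restrict (Ioi (0 : ℝ) ×ˢ univ))
  have hf₂ : ∀ T : ℝ, 0 < T → ∫⁻ _ in Ioo (0 : ℝ) T, ∫⁻ x, ‖f x‖ₑ ^ 2 < ⊤ := fun T _ =>
    lintegral_force_lt_top hf T
  -- the field of `ω` (no shift) and coefficientwise convergence
  obtain ⟨u, hum, hu⟩ := exists_pathField hω 0
  simp only [zero_add] at hu
  have hu2 : ∀ t, 0 ≤ t → MemLp (u t) 2 volume := fun t ht => (hu t ht).1
  have hcoefU : ∀ j t, 0 ≤ t → ∀ k, mFourierCoeff (EuclideanSpace.complexify ∘ U j t) k =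
      pathExt (orbitPath ν (fourierRestrict (freqBall (N j)) f) (c j)) t k := fun j t ht k => by
    rw [hUjt, mFourierCoeff_galerkinFlow_realTrigPoly (hc j),
      pathExt_orbitPath hν.le (hS j) (hg j) (hc j) (hmem j) ht k]
  have hcv : ∀ t, 0 ≤ t → ∀ k, Tendsto (fun j => mFourierCoeff (EuclideanSpace.complexify ∘ U j t) k)
      atTop (𝓝 (mFourierCoeff (EuclideanSpace.complexify ∘ u t) k)) := by
    intro t ht k
    rw [(hu t ht).2 k]
    exact (hlim t ht k).congr fun j => (hcoefU j t ht k).symm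
  -- strong convergence at a.e. time along a subsequence
  obtain ⟨φ, hφ, hae⟩ := hF.exists_strictMono_ae_tendsto_eLpNorm hν hu₀ hfm hf₂ hum hu2 hcv one_pos
  -- pick a strong time `s ∈ (0, 1)`
  have hne : NeBot (ae (volume.restrict (Ioo (0 : ℝ) 1))) := by
    rw [ae_neBot, Ne, Measure.restrict_eq_zero]
    simp
  obtain ⟨s, hs_strong, hs_mem⟩ := (hae.and (ae_restrict_mem measurableSet_Ioo)).exists
  have hs : 0 ≤ s := hs_mem.1.le
  -- the restarted data and orbits
  set c' : (j : ℕ) → ↥(freqBall (N (φ j)) : Finset (Fin 3 → ℤ)) → EuclideanSpace ℂ (Fin 3) := fun j =>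
    galerkinCoeffFlow ν (fourierRestrict (freqBall (N (φ j))) f) s (c (φ j)) with hc'
  have hc'mem : ∀ j, c' j ∈ galerkinSubspace (freqBall (N (φ j))) := fun j =>
    galerkinCoeffFlow_mem (hc (φ j)) s
  have hR' : ∀ j, ∑ k ∈ freqBall (N (φ j)), ‖coeffExt (freqBall (N (φ j))) (c' j) k‖ ^ 2 ≤ R ^ 2 :=
    fun j => hconf (φ j) s hs
  have hflow : ∀ j t, 0 ≤ t → galerkinCoeffFlow ν (fourierRestrict (freqBall (N (φ j))) f) t (c' j) =
      galerkinCoeffFlow ν (fourierRestrict (freqBall (N (φ j))) f) (t + s) (c (φ j)) := fun j t ht => by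
    rw [hc', ← galerkinCoeffFlow_add hν.le (hS (φ j)) (hg (φ j)) (hc (φ j)) ht hs]
  obtain ⟨U', hU'⟩ : ∃ U' : ℕ → ℝ → UnitAddTorus (Fin 3) → EuclideanSpace ℝ (Fin 3),
      U' = fun j t => galerkinFlow ν f (N (φ j)) t
        (realTrigPoly (freqBall (N (φ j))) (coeffExt (freqBall (N (φ j))) (c' j))) := ⟨_, rfl⟩
  have hU'jt : ∀ j t, U' j t = galerkinFlow ν f (N (φ j)) t
      (realTrigPoly (freqBall (N (φ j))) (coeffExt (freqBall (N (φ j))) (c' j))) := fun j t => by rw [hU']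
  have hF' : IsHopfGalerkinFamily ν (fun _ => f) (fun _ => EuclideanSpace.single (0 : Fin 3) R) (N ∘ φ)
      (fun _ _ => f) U' := by
    rw [hU']; exact isHopfGalerkinFamily_galerkinFlow hν.le hf (hN.comp hφ.tendsto_atTop) hc'mem hR'
  -- the field of `ω` shifted by `s`
  obtain ⟨u', hum', hu'⟩ := exists_pathField hω s
  have hu'2 : ∀ t, 0 ≤ t → MemLp (u' t) 2 volume := fun t ht => (hu' t ht).1
  -- coefficients of the restarted orbits and their convergence
  have hcoefU' : ∀ j t, 0 ≤ t → ∀ k, mFourierCoeff (EuclideanSpace.complexify ∘ U' j t) k =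
      pathExt (orbitPath ν (fourierRestrict (freqBall (N (φ j))) f) (c (φ j))) (s + t) k := by
    intro j t ht k
    rw [hU'jt, mFourierCoeff_galerkinFlow_realTrigPoly (hc'mem j), hflow j t ht,
      pathExt_orbitPath hν.le (hS (φ j)) (hg (φ j)) (hc (φ j)) (hmem (φ j)) (by positivity) k,
      add_comm t s]
  have hcv' : ∀ t, 0 ≤ t → ∀ k, Tendsto (fun j => mFourierCoeff (EuclideanSpace.complexify ∘ U' j t) k)
      atTop (𝓝 (mFourierCoeff (EuclideanSpace.complexify ∘ u' t) k)) := by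
    intro t ht k
    rw [(hu' t ht).2 k]
    have h := (hlim (s + t) (by positivity) k).comp hφ.tendsto_atTop
    exact h.congr fun j => (hcoefU' j t ht k).symm
  -- strong convergence at the new initial time
  have h0' : Tendsto (fun j => eLpNorm (U' j 0 - u' 0) 2 volume) atTop (𝓝 0) := by
    have hUs : ∀ j, U' j 0 = U (φ j) s := fun j => by
      rw [hU'jt, galerkinFlow_zero, hUjt, galerkinFlow_realTrigPoly (hc (φ j))]
    have hus : eLpNorm (u s - u' 0) 2 volume = 0 := by
      refine eLpNorm_sub_eq_zero_of_mFourierCoeff_eq (hu2 s hs) (hu'2 0 le_rfl) fun k => ?_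
      rw [(hu s hs).2 k, (hu' 0 le_rfl).2 k, add_zero]
    have hle : ∀ j, eLpNorm (U' j 0 - u' 0) 2 volume ≤ eLpNorm (U (φ j) s - u s) 2 volume := by
      intro j
      rw [hUs j]
      have hsplit : U (φ j) s - u' 0 = (U (φ j) s - u s) + (u s - u' 0) := by abel
      rw [hsplit]
      refine (eLpNorm_add_le ?_ ?_ one_le_two).trans ?_
      · exact ((hF.memLp_slice (φ j) hs).sub (hu2 s hs)).aestronglyMeasurable
      · exact ((hu2 s hs).sub (hu'2 0 le_rfl)).aestronglyMeasurable
      · rw [hus, add_zero]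
    exact tendsto_of_tendsto_of_tendsto_of_le_of_le tendsto_const_nhds hs_strong
      (fun j => bot_le) hle
  -- the family theorem from the new datum
  have hLH := hF'.isGlobalLerayHopf_limit hν hu₀ hfm hf₂ hum' hu'2 hcv' h0'
  exact ⟨s, hs, u', hLH, hu'⟩

end Summit.AnomalousDissipation.AnomalousDissipation.Theorems.MomentParity
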